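/-
Copyright (c) 2026 the pub-hodgecm-mathlib formalisation cell (harness21).  Prover seat hodgecm-mathlib-K2E3-p12 (g8), Track B ∕ K2-LIT, h413 = `stmt-HodgeConjecture-24833`,
line `K2_E1_TraceFormulaBeta`, 5Res ROADCARD (154)∕(277) §3: the general-rank PACKAGING of a consistent sesquilinear coefficient matrix on a spanning family as an operator —
`∃ M, ⟪v_b, M v_a⟫ = B a b` — Mathlib-only linear algebra (Fréchet–Riesz + linear extension through a surjection).
-/
import Mathlib.Analysis.InnerProductSpace.Dual
import Mathlib.Analysis.InnerProductSpace.PiL2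
import Mathlib.LinearAlgebra.Quotient.Basic
import HarnessLib

/-!
# `K2E1SesquilinearRieszPackaging`: `∃ M : W →ₗ[ℂ] W, ⟪v b, M (v a)⟫ = B a b` FOR A CONSISTENT COEFFICIENT MATRIX ON A SPANNING FINITE FAMILY

Track B ∕ K2-LIT, crux h413 = `stmt-HodgeConjecture-24833`, route of record `HCCMUnconditional`; cell `hodgecm-mathlib`, squad K2, ENGINE E1.  THEOREMS ONLY (no `def`, no `instance`,
no `notation`, no named-fact hypothesis, no `sorry`); lane `--supports stmt-HodgeConjecture-24833 --as helper` (count-neutral).  Pure Mathlib linear algebra.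
THE MATHEMATICS ([ReedSimonI1980, Thm. II.4]; dealer (277) §3).  See the head's docstring.
* `quotKerEquivOfSurjective_symm_apply`, `eq_zero_of_forall_inner_eq_zero`, **`exists_linearMap_inner_eq`**.
HONEST LABEL: HC_CM is proved only modulo the 7 printed citations (2 remaining named inputs: hLiu418 = `stmt-HodgeConjecture-24832`, h413 = `stmt-HodgeConjecture-24833`) until rung 0
closes; this file asserts no named fact, closes no socket; count-neutral; letter-free.

## References
* [ReedSimonI1980] M. Reed, B. Simon, *Methods of Modern Mathematical Physics I: Functional Analysis* (1980), Thm. II.4.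
-/

set_option autoImplicit false
set_option linter.dupNamespace false  -- the mandated namespace repeats the summit's segment (`HodgeConjecture.HodgeConjecture`)

noncomputable section

open Submodule
open scoped InnerProductSpace ComplexConjugate

namespace Summit.HodgeConjecture.HodgeConjecture.Cruxes.H413.K2E1SesquilinearRieszPackaging

variable {W : Type*} [NormedAddCommGroup W] [InnerProductSpace ℂ W] {α : Type*}

/-- `(f.quotKerEquivOfSurjective hf).symm (f x) = [x]`. [folklore] -/
theorem quotKerEquivOfSurjective_symm_apply {M M₂ : Type*} [AddCommGroup M] [Module ℂ M] [AddCommGroup M₂] [Module ℂ M₂]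
    (f : M →ₗ[ℂ] M₂) (hf : Function.Surjective f) (x : M) : (f.quotKerEquivOfSurjective hf).symm (f x) = Submodule.Quotient.mk x := by
  rw [LinearEquiv.symm_apply_eq]
  rfl

/-- A vector orthogonal to a SPANNING family is `0`. [folklore] -/
theorem eq_zero_of_forall_inner_eq_zero (v : α → W) (hv : span ℂ (Set.range v) = ⊤) (x : W) (hx : ∀ b, ⟪v b, x⟫_ℂ = 0) : x = 0 := by
  have hmem : x ∈ (span ℂ (Set.range v))ᗮ := by
    rw [Submodule.mem_orthogonal]
    intro u hu
    refine Submodule.span_induction (p := fun u _ => ⟪u, x⟫_ℂ = 0) ?_ ?_ ?_ ?_ hu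
    · rintro _ ⟨b, rfl⟩; exact hx b
    · exact inner_zero_left _
    · intro u u' _ _ hu hu'; rw [inner_add_left, hu, hu', add_zero]
    · intro r u _ hu; rw [inner_smul_left, hu, mul_zero]
  rwa [hv, Submodule.top_orthogonal_eq_bot, Submodule.mem_bot] at hmem

/-- **RIESZ PACKAGING OF A CONSISTENT SESQUILINEAR COEFFICIENT MATRIX.**  `W` a finite-dimensional complex inner product space, `v : α → W` a finite SPANNING family (not necessarily
independent), `B : α → α → ℂ` a coefficient matrix CONSISTENT with the linear relations of `v` in both slots (linear in the first index, conjugate-linear in the second: `Σ c_a v_a = 0 ⇒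
Σ c_a B a b = 0` and `Σ d_b v_b = 0 ⇒ Σ conj d_b · B a b = 0`).  THEN there is a linear `M : W → W` with **`⟪v b, M (v a)⟫ = B a b`** for all `a, b`: the well-defined conjugate-linear
functionals `v_b ↦ conj B a b` are represented (Fréchet–Riesz, Mathlib `InnerProductSpace.toDual`) by vectors `w_a`, and `v_a ↦ w_a` extends linearly through the surjection
`(α → ℂ) ↠ W` (Mathlib `liftQ` ∘ `quotKerEquivOfSurjective`).  USE (ROADCARD (154) (SD), dealer (277) §3): `W = span{v_a} ≤ L²(K_U)`, `B = B_z` the section pairing of ★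
`K2E1ChiPseudoEisensteinSelfDualVectorGramCMTwo` (consistent by ★ `K2E1ChiSectionDeterminedByMaximalCompactU2`) ⇒ the operator `M z` of the `hSD` letter of ★ `K2E1ChiSectionPlancherelSelfDualCMTwo`.
[cite: ReedSimonI1980, Thm. II.4 (Riesz lemma)] -/
theorem exists_linearMap_inner_eq [FiniteDimensional ℂ W] [Fintype α] [DecidableEq α] (v : α → W) (hv : span ℂ (Set.range v) = ⊤) (B : α → α → ℂ)
    (hB₁ : ∀ c : α → ℂ, ∑ a, c a • v a = 0 → ∀ b, ∑ a, c a * B a b = 0)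
    (hB₂ : ∀ d : α → ℂ, ∑ b, d b • v b = 0 → ∀ a, ∑ b, conj (d b) * B a b = 0) :
    ∃ M : W →ₗ[ℂ] W, ∀ a b, ⟪v b, M (v a)⟫_ℂ = B a b := by
  classical
  haveI : CompleteSpace W := FiniteDimensional.complete ℂ W
  set S : (α → ℂ) →ₗ[ℂ] W := Fintype.linearCombination ℂ v with hS
  have hSapply : ∀ d : α → ℂ, S d = ∑ b, d b • v b := fun d => Fintype.linearCombination_apply ℂ v d
  have hSsurj : Function.Surjective S := by
    rw [← LinearMap.range_eq_top, hS, Fintype.range_linearCombination, hv]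
  have hSsingle : ∀ a, S (Pi.single a 1) = v a := fun a => by
    rw [hSapply]; simp [Pi.single_apply]
  -- (i)+(ii): the vectors `w a`
  have hw : ∀ a, ∃ w : W, ∀ b, ⟪v b, w⟫_ℂ = B a b := by
    intro a
    set La : (α → ℂ) →ₗ[ℂ] ℂ := Fintype.linearCombination ℂ (fun b => conj (B a b)) with hLa
    have hLa' : ∀ d : α → ℂ, La d = ∑ b, d b * conj (B a b) := fun d => by
      rw [hLa, Fintype.linearCombination_apply]; rfl
    have hker : LinearMap.ker S ≤ LinearMap.ker La := by
      intro d hd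
      rw [LinearMap.mem_ker] at hd ⊢
      rw [hSapply] at hd
      have h := congrArg conj (hB₂ d hd a)
      rw [map_sum, map_zero] at h
      rw [hLa', ← h]
      exact Finset.sum_congr rfl fun b _ => by rw [map_mul, Complex.conj_conj]
    set Λ : W →ₗ[ℂ] ℂ := ((LinearMap.ker S).liftQ La hker).comp (S.quotKerEquivOfSurjective hSsurj).symm.toLinearMap with hΛ
    have hΛS : ∀ d, Λ (S d) = La d := fun d => by
      simp only [hΛ, LinearMap.comp_apply, LinearEquiv.coe_toLinearMap, quotKerEquivOfSurjective_symm_apply]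
      exact Submodule.liftQ_apply _ _ _
    refine ⟨(InnerProductSpace.toDual ℂ W).symm (LinearMap.toContinuousLinearMap Λ), fun b => ?_⟩
    rw [← inner_conj_symm, InnerProductSpace.toDual_symm_apply, LinearMap.coe_toContinuousLinearMap', ← hSsingle b, hΛS, hLa']
    simp [Pi.single_apply]
  choose w hw using hw
  -- (iii): `M` with `M (v a) = w a`
  set Lw : (α → ℂ) →ₗ[ℂ] W := Fintype.linearCombination ℂ w with hLw
  have hLw' : ∀ c : α → ℂ, Lw c = ∑ a, c a • w a := fun c => Fintype.linearCombination_apply ℂ w c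
  have hker' : LinearMap.ker S ≤ LinearMap.ker Lw := by
    intro c hc
    rw [LinearMap.mem_ker] at hc ⊢
    rw [hSapply] at hc
    refine eq_zero_of_forall_inner_eq_zero v hv _ fun b => ?_
    rw [hLw', inner_sum]
    simp only [inner_smul_right, hw]
    exact hB₁ c hc b
  refine ⟨((LinearMap.ker S).liftQ Lw hker').comp (S.quotKerEquivOfSurjective hSsurj).symm.toLinearMap, fun a b => ?_⟩
  have hM : (((LinearMap.ker S).liftQ Lw hker').comp (S.quotKerEquivOfSurjective hSsurj).symm.toLinearMap) (v a) = w a := by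
    rw [← hSsingle a]
    simp only [LinearMap.comp_apply, LinearEquiv.coe_toLinearMap, quotKerEquivOfSurjective_symm_apply]
    rw [Submodule.liftQ_apply, hLw']
    simp [Pi.single_apply]
  rw [hM, hw]


end Summit.HodgeConjecture.HodgeConjecture.Cruxes.H413.K2E1SesquilinearRieszPackaging

end
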